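import Summits.QuantumFields.BalabanUV.Beta.LambdaPieceReflection
import Literature.MathematicalPhysics.QuantumFieldTheory.Balaban1983to89.Beta.BalabanStepJetsSucc

/-!
# The Λ-SLICE of the step-`j` stencil obeys the PURE-SIGN reflection law (Sr) at EVERY level: `refK_mmRead`, `refK_E2`,
# `refK_comp_KInvStep_E2`, `lamCoeffK_reflect`, and
# `SLam Lc (lamCoeffK (KInvStep Lc j) (E2 d Lc j) Lc) (hessFFAt ρ_c Lc) κ′ (bref α κ′ u) = ε_{κ′} • refK (Φ Lc α) (SLam … κ′ u)`
# (β sub-cell, row BETA-an2, gen 14; NOTE X-an2-45 §3 / (R45-4); the Λ third of hSrC at `j ≥ 1` — NO contact, any binder `𝕄_j`)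

HONEST FRAMING (cell charter, verbatim): «discharging BetaPertH makes Balaban's UV stability UNCONDITIONAL — a real
constructive-QFT result; it is NOT the continuum limit and NOT the Clay problem.»  DERIVED cell leaf (pub-balaban β sub-cell, lane
an2 gen 14); no statement of Bałaban's papers is typed here, no `[cite:]` tag, no `Prop` fact; it instantiates no binder of the
β-function wall by itself.  NOT `BetaPertH`; NOT continuum; NOT Clay.

## What is here ([folklore] bookkeeping over `LambdaPieceReflection`, an2's `BalabanStepJetsSucc` (`mmRead`, `E2`, `lamCoeffK`) and an5's
`ResolventReflection` (`refK_KInv`, `refK_KInvStep`, `mref_zsmul`, `comp_refK`))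

* `refK_mmRead`: `refK (Φ N α) (mmRead M K) = mmRead M (refK (Φ M α) K)` — reading the multiplier block of a level-`M` kernel on the
  step lattice commutes with the axis reflection (`mref M α a (M•x′) = M • bref α a x′`, `mref_zsmul`; the signs do not depend on the level);
* `refK_E2`: the unit `E2 d Lc j = mmRead (Lc^j) (KInv (Lc^j))` is reflection-invariant; `summable_KInvStep_mul_E2` (one summed leg, from
  `decays_KInvStep`, `decays_E2`, `summable_bdd_mul_decay`); `refK_comp_KInvStep_E2`: so is `KInvStep Lc j ∘ E2 d Lc j` (`comp_refK`);
* `lamCoeffK_reflect`: for ANY pair `(A, E)` with `refK (Φ N α) (A ∘ E) = A ∘ E`,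
  `lamCoeffK A E N μ (bref α μ y) κ′ (bref α κ′ u) = ε_{κ′} ε_μ · lamCoeffK A E N μ y κ′ u`;
* **`SLam_lamCoeffK_hessFFAt_reflect`**: for odd `Lc`, every `j`, axis `α` and jet bond `(κ′, u)`, the Λ-stencil of `SstepNAt ρ_c … j`
  (`(cΛ·wΛ j) • SLam Lc (lamCoeffK (KInvStep Lc j) (E2 d Lc j) Lc) (hessFFAt ρ_c Lc)`) reflects by the pure sign `ε_{κ′}` — it contributes NO
  contact to the socket hSrC of `SpineRooted.axisReflectionCovariant_flipK_TbalOf_JsBalBm(N)AtOf_ctrC` at any level (`smul_SLam_step_reflect`).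

All declarations `[folklore]`; axioms standard.  Provenance: b2b-balaban β sub-cell, unit beta-an2 gen 14, 2026-08-20 (v1); no existing file touched.
-/

open Finset
open scoped BigOperators
open Literature.MathematicalPhysics.QuantumFieldTheory
open Literature.MathematicalPhysics.QuantumFieldTheory.Balaban1983to89
open Literature.MathematicalPhysics.QuantumFieldTheory.Balaban1983to89.Beta
open B12Sec2to5 (l1 l1_nonneg)
open ExpKernelCalculus (MKer Decays comp)
open AveragingContoursRooted (ctr ctrOff)
open AveragingHessianKernelsRooted (hessFFAt)
open RootedKernelReflection (hessFFAt_reflect)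
open PolarizationSign (reflSign)
open KernelReflection (LegMap refK refK_apply comp_refK)
open ResolventReflection (bref bref_bref mref mref_zsmul Φ Φ_r_inl Φ_r_inr Φ_s_inl Φ_s_inr reflSign_mul_self refK_KInv refK_KInvStep)
open OneStepResolventKernel (Fib KInv)
open OneStepKernelFamily (KInvStep decays_KInvStep)
open InterLevelTransport (SLam summable_bdd_mul_decay)
open BalabanStepJetsSucc (mmRead E2 lamCoeffK decays_E2 wΛ)

noncomputable section

namespace Summit.QuantumFields.BalabanUV.Beta.SpineRooted

variable {d : ℕ}

/-! ## §1 Reading the multiplier block commutes with the reflection -/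

/-- [folklore] **`refK (Φ N α) (mmRead M K) = mmRead M (refK (Φ M α) K)`**. -/
theorem refK_mmRead (M N : ℕ) (α : Fin (d + 1)) (K : MKer (d + 1) (Fib d)) :
    refK (Φ (d := d) N α) (mmRead M K) = mmRead M (refK (Φ (d := d) M α) K) := by
  funext x' z' a b
  rw [refK_apply]
  rcases a with a | μ <;> rcases b with b | ν
  · show (Φ (d := d) N α).s (Sum.inl a) * (Φ (d := d) N α).s (Sum.inl b) *
        K ((M : ℤ) • (Φ (d := d) N α).r (Sum.inl a) x') ((M : ℤ) • (Φ (d := d) N α).r (Sum.inl b) z') (Sum.inr a) (Sum.inr b) =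
      refK (Φ (d := d) M α) K ((M : ℤ) • x') ((M : ℤ) • z') (Sum.inr a) (Sum.inr b)
    rw [refK_apply, Φ_r_inl, Φ_r_inl, Φ_r_inr, Φ_r_inr, mref_zsmul, mref_zsmul, Φ_s_inl, Φ_s_inl, Φ_s_inr, Φ_s_inr]
  · show _ * _ * (0 : ℝ) = 0
    rw [mul_zero]
  · show _ * _ * (0 : ℝ) = 0
    rw [mul_zero]
  · show _ * _ * (0 : ℝ) = 0
    rw [mul_zero]

/-- [folklore] **THE UNIT `E2 d Lc j` IS REFLECTION-INVARIANT** on the step-`j` lattice. -/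
theorem refK_E2 {Lc : ℕ} [NeZero Lc] (j : ℕ) (α : Fin (d + 1)) : refK (Φ (d := d) Lc α) (E2 d Lc j) = E2 d Lc j := by
  unfold BalabanStepJetsSucc.E2
  rw [refK_mmRead, refK_KInv]

/-- [folklore] One summed leg of `KInvStep Lc j ∘ E2 d Lc j` is absolutely summable. -/
theorem summable_KInvStep_mul_E2 {Lc : ℕ} [NeZero Lc] (j : ℕ) (x z : Fin (d + 1) → ℤ) (a f b : Fib d) :
    Summable fun y : Fin (d + 1) → ℤ => KInvStep (d := d) Lc j x y a f * E2 d Lc j y z f b := by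
  obtain ⟨δ, C, hδ, hC, hK⟩ := decays_KInvStep (d := d) (Lc := Lc) j
  obtain ⟨δ', C', hδ', hC', hE⟩ := decays_E2 (d := d) (Lc := Lc) j
  refine summable_bdd_mul_decay (Cρ := C) (Cφ := C') (δ := δ') (q := z) (fun t => ?_) (fun t => ?_) hδ'
  · refine (hK x t a f).trans ?_
    have h1 : Real.exp (-δ * l1 (x - t)) ≤ 1 := Real.exp_le_one_iff.2 (by nlinarith [l1_nonneg (x - t)])
    calc C * Real.exp (-δ * l1 (x - t)) ≤ C * 1 := mul_le_mul_of_nonneg_left h1 hC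
      _ = C := mul_one C
  · exact hE t z f b

/-- [folklore] **`KInvStep Lc j ∘ E2 d Lc j` IS REFLECTION-INVARIANT**. -/
theorem refK_comp_KInvStep_E2 {Lc : ℕ} [NeZero Lc] (j : ℕ) (α : Fin (d + 1)) :
    refK (Φ (d := d) Lc α) (comp (KInvStep (d := d) Lc j) (E2 d Lc j)) = comp (KInvStep (d := d) Lc j) (E2 d Lc j) := by
  rw [← comp_refK _ (fun x z a f b => summable_KInvStep_mul_E2 j x z a f b), refK_KInvStep, refK_E2]

/-! ## §2 The conversion coefficients transform by pure signs -/

/-- [folklore] **`lamCoeffK` TRANSFORMS BY PURE SIGNS** under the reflection of axis `α`, for any pair whose composition is reflection-invariant. -/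
theorem lamCoeffK_reflect {N : ℕ} {A E : MKer (d + 1) (Fib d)} {α : Fin (d + 1)} (hAE : refK (Φ (d := d) N α) (comp A E) = comp A E)
    (μ : Fin (d + 1)) (y : Fin (d + 1) → ℤ) (κ' : Fin (d + 1)) (u : Fin (d + 1) → ℤ) :
    lamCoeffK A E N μ (bref α μ y) κ' (bref α κ' u) = reflSign α κ' * reflSign α μ * lamCoeffK A E N μ y κ' u := by
  unfold BalabanStepJetsSucc.lamCoeffK
  conv_lhs => rw [← hAE]
  rw [refK_apply, Φ_s_inr, Φ_s_inl, Φ_r_inr, Φ_r_inl, mref_zsmul, bref_bref, bref_bref]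
  ring

/-! ## §3 The Λ-stencil of the step-`j` spine reflects by a pure sign -/

/-- [folklore] **THE Λ-STENCIL OF `SstepNAt ρ_c … j` OBEYS (Sr) WITH NO CONTACT** (odd `Lc`, every `j`). -/
theorem SLam_lamCoeffK_hessFFAt_reflect {Lc : ℕ} [NeZero Lc] (hLc : Odd Lc) (j : ℕ) (α κ' : Fin (d + 1)) (u : Fin (d + 1) → ℤ) :
    SLam Lc (lamCoeffK (KInvStep (d := d) Lc j) (E2 d Lc j) Lc) (fun μ y => hessFFAt (ctr (d + 1) Lc) Lc μ y) κ' (bref α κ' u) =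
      reflSign α κ' • refK (Φ Lc α)
        (SLam Lc (lamCoeffK (KInvStep (d := d) Lc j) (E2 d Lc j) Lc) (fun μ y => hessFFAt (ctr (d + 1) Lc) Lc μ y) κ' u) :=
  SLam_reflect (fun μ y κ'' u' => lamCoeffK_reflect (refK_comp_KInvStep_E2 j α) μ y κ'' u')
    (fun μ y => hessFFAt_reflect hLc Lc α μ y) κ' u

/-- [folklore] The same with the step weight: the Λ summand `(cΛ·wΛ j) • SLam …` of `SstepNAt ρ_c cE cVH cΛ j` reflects by `ε_{κ′}`. -/
theorem smul_SLam_step_reflect {Lc : ℕ} [NeZero Lc] (hLc : Odd Lc) (cΛ : ℝ) (j : ℕ) (α κ' : Fin (d + 1)) (u : Fin (d + 1) → ℤ) :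
    (cΛ * wΛ d Lc j) • SLam Lc (lamCoeffK (KInvStep (d := d) Lc j) (E2 d Lc j) Lc) (fun μ y => hessFFAt (ctr (d + 1) Lc) Lc μ y) κ'
        (bref α κ' u) =
      reflSign α κ' • refK (Φ Lc α)
        ((cΛ * wΛ d Lc j) • SLam Lc (lamCoeffK (KInvStep (d := d) Lc j) (E2 d Lc j) Lc) (fun μ y => hessFFAt (ctr (d + 1) Lc) Lc μ y) κ' u) := by
  rw [SLam_lamCoeffK_hessFFAt_reflect hLc j α κ' u]
  funext x z a b
  simp only [Pi.smul_apply, smul_eq_mul, refK_apply]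
  ring

end Summit.QuantumFields.BalabanUV.Beta.SpineRooted
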